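import Literature.AlgebraicGeometry.Frobenioids.PadicFrobenioidUnitGroups
import Literature.AlgebraicGeometry.Frobenioids.PadicFieldwiseSaturatedPrelim
import HarnessLib

/-!
# Frobenioids II, Thm. 2.4 (ii), first step (α2): `O^▷(A)^gp = B(A_D)` for a FIELDWISE SATURATED `p`-adic Frobenioid

Mochizuki, *The geometry of Frobenioids II*, Kyushu J. Math. **62** (2008) 401–460, §2, proof of Theorem
2.4 (ii), p. 20 l.−3 – p. 21 l.6 [cite: MochizukiFrdII2008, Thm 2.4 (ii) p.20], VERBATIM (author's PDF,
`paper:url-4322d76898e0` p. 20 last 3 lines – p. 21 l. 6, read 2026-08-26): "Then since `Φᵢ` is fieldwise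
saturated, it follows — by varying the objects `Aᵢ` [that correspond via `Ψ`] and reconstructing the
multiplicative group associated to the field determined by the image of `Aᵢ` in `B(Gᵢ, Gᵢ°)` as the
groupification of the monoid `O^▷(Aᵢ) = O^□(Aᵢ)` — that `Ψ` induces a pair of compatible isomorphisms
`G₁ ⥲ G₂`; `K̄₁^× ⥲ K̄₂^×` — where this pair is well-defined up to composition with automorphisms of the pair
`(G₂, K̄₂^×)` induced by elements of `G₂`."  And p. 20 (proof of (i)): "`Ψ` induces a 1-compatible
equivalence of categories `Ψ^Base : D₁ ⥲ D₂`, as well as compatible isomorphisms of functors `Φ₁ ⥲ Φ₂`,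
`B₁ ⥲ B₂` — where we regard “`O^▷(−)`” as a subfunctor of `Bᵢ` [such that `Bᵢ` is the groupification of
“`O^▷(−)`”] which is preserved by the isomorphism `B₁ ⥲ B₂`".

PROOF-ONLY file (abc-iut cell, layer L1, `plan/L1/SUBDAG-FrdII-Thm24.md` row **W12-L17 `PairIso`**, piece
(α2) of the census of seat abc-iut-w5-d188, L1-lead R97 (5)(a) GO), companion of
`PadicFrobenioidFieldUnitsReconstruction.lean` ((α1): `B(A_D) ⥲ K_A^×`).  For an object `X = (A_D, α)` of the
`p`-adic Frobenioid `C = d.frobenioid` (abc-iut-L1-t4's `PadicFrd.Datum`; [FrdI] Thm. 5.2 (i) model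
Frobenioid), the monoid `O^▷(X)` of [FrdI] Def. 1.2 (ii) (found's `PreFrobenioid.endSubmonoid` of the
structure functor) maps to `B(A_D)` by `f ↦ u_f`, INJECTIVELY and with EFFECTIVE divisors
`Div_B(u_f) = [Div(f)]` (abc-iut-L1-t4's `PadicFrobenioidSplittingMonoid.lean`: `of_div_eq_divB_unit`,
`eq_of_mem_of_unit_eq`, `unit_comp_of_mem`, `unitEnd_mem_endSubmonoid` — used by name).  PROVED here:

* **`exists_unit_mul_eq_unit_of_isFieldwiseSaturated`** — if `Φ` is FIELDWISE SATURATED then every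
  `b ∈ B(A_D)` is a fraction `u_f · u_g⁻¹` of two elements of `O^▷(X)`: with a uniformizer `π` of `K_A`
  (abc-iut-w5-d229's `exists_uniformizer`) and `c₀ ∈ Φ(A_D)` with `[ι c₀] = ord(π)`
  (`exists_phiGp_eq_generator` — the EFFECTIVITY that fieldwise saturation buys), the cartesian square gives
  `Div_B(b) = [c₀]^k`, `k ∈ ℤ`; for `k ≥ 0` take `g = id`, `f = (1, id, c₀^k, b)`; for `k < 0` take
  `g = (1, id, c₀^{−k}, w)` with `w ∈ B(A_D)` over `(π^{−k}, [c₀]^{−k})` and `f = (1, id, 0, b·w)`.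
So the subgroup of `B(A_D)` generated by the `u_f`, `f ∈ O^▷(X)` — which IS `O^▷(X)^gp`, `f ↦ u_f` being
injective and multiplicative — is all of `B(A_D)`; with (α1), `O^▷(X)^gp ≅ K_A^×`, the per-object half of the
printed reconstruction (the colimit over `A` and the transport along `Ψ` are pieces (β)/(γ)).  Theorems only;
nothing here bears on [IUTchIII] Cor. 3.12.
-/

namespace Literature.AlgebraicGeometry.Frobenioids

open CategoryTheory Opposite Function

universe v u

namespace PadicFrd.Datum

variable {D : Type u} [Category.{v} D] {p : ℕ} [Fact p.Prime] (d : Datum D p)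

/-- `Div₀(π^n) = ord(π)^n` for `π ∈ O_K^⊳`. [cite: MochizukiFrdII2008, Ex 1.1 (i) p.7] -/
theorem divZeroHom_pow_intNonzeroToUnits (A : D) (π : intNonzero (d.fld A)) (n : ℕ) :
    divZeroHom (d.fld A) (intNonzeroToUnits (d.fld A) π ^ n) = d.ordIntGp A (Associates.mk π) ^ n := by
  rw [map_pow, d.ordIntGp_mk_eq_divZeroHom A π]

/-- For a fieldwise saturated datum, the divisor of EVERY `b ∈ B(A_D)` is an integer power of the
effective generator class: `Div_B(b) = [c₀]^k` where `[ι c₀] = ord(π)` (`Div₀(b|_{K^×}) ∈ ord(K^×) = ℤ·ord(π)`,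
the cartesian square, and injectivity of `ι^gp`). [cite: MochizukiFrdII2008, Thm 2.4 (ii) p.20] -/
theorem exists_divB_eq_of_zpow (X : d.frobenioid) {π : intNonzero (d.fld X.base)}
    (hπ : ∀ a : OrdInt (d.fld X.base), ∃ k : ℕ, a = Associates.mk π ^ k)
    {c₀ : d.Φ.obj (op X.base)} (hc₀ : d.phiGp X.base c₀ = d.ordIntGp X.base (Associates.mk π))
    (b : d.B.obj (op X.base)) :
    ∃ k : ℤ, Frobenioids.divB d.Φ d.B d.divB (op X.base) b = Algebra.GrothendieckGroup.of c₀ ^ k := by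
  obtain ⟨k, hk⟩ := d.exists_zpow_eq_of_mem_ordUnitsSubgroup X.base hπ
    (d.divZeroHom_mem_ordUnitsSubgroup X.base ((d.toB0.app (op X.base)).hom b))
  refine ⟨k, d.monGp_map_ιHom_injective X.base ?_⟩
  rw [map_zpow, ← d.phiGp_eq_monGp_map_of, hc₀, ← hk]
  exact (d.square_apply (op X.base) b).symm

/-- **`O^▷(X)^gp = B(A_D)` for a fieldwise saturated `p`-adic Frobenioid** (print, p. 20: "we regard
“`O^▷(−)`” as a subfunctor of `Bᵢ` [such that `Bᵢ` is the groupification of “`O^▷(−)`”]"; p. 20 l.−2 –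
p. 21 l. 2: "reconstructing the multiplicative group associated to the field determined by the image of `Aᵢ`
… as the groupification of the monoid `O^▷(Aᵢ)`"): every
`b ∈ B(A_D)` is `u_f · u_g⁻¹` for base-identity linear endomorphisms `f, g ∈ O^▷(X)`.
[cite: MochizukiFrdII2008, Thm 2.4 (ii) p.20] -/
theorem exists_unit_mul_eq_unit_of_isFieldwiseSaturated (hfs : d.IsFieldwiseSaturated)
    (X : d.frobenioid) (b : d.B.obj (op X.base)) :
    ∃ f g : X ⟶ X, f ∈ PreFrobenioid.endSubmonoid d.structureFunctor X ∧
      g ∈ PreFrobenioid.endSubmonoid d.structureFunctor X ∧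
        b * ModelFrobenioid.unit g = ModelFrobenioid.unit f := by
  -- a uniformizer `π` of `K_A` and `c₀ ∈ Φ(A_D)` with `[ι c₀] = ord(π)` (effectivity from fieldwise saturation)
  obtain ⟨π, hπ1, hπ⟩ := d.exists_uniformizer X.base
  obtain ⟨c₀, hc₀⟩ := d.exists_phiGp_eq_generator hfs X.base hπ1
  obtain ⟨k, hγ⟩ := d.exists_divB_eq_of_zpow X hπ hc₀ b
  rcases Int.eq_nat_or_neg k with ⟨n, rfl | rfl⟩
  · -- `k = n ≥ 0`: `Div_B b = [c₀^n]` is effective; `f = (1, id, c₀^n, b)`, `g = id`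
    rw [zpow_natCast, ← map_pow] at hγ
    exact ⟨ModelFrobenioid.unitEnd X (c₀ ^ n) b hγ.symm, 𝟙 X, d.unitEnd_mem_endSubmonoid X _ _ _,
      (PreFrobenioid.endSubmonoid d.structureFunctor X).one_mem,
      by rw [ModelFrobenioid.unit_id, mul_one]; rfl⟩
  · -- `k = −n`: `w ∈ B(A_D)` over `(π^n, [c₀]^n)`; `Div_B(b·w) = 0`; `f = (1, id, 0, b·w)`, `g = (1, id, c₀^n, w)`
    have hcompat : divZeroHom (d.fld X.base) (intNonzeroToUnits (d.fld X.base) π ^ n) =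
        MonGp.map (d.ι.app (op X.base)).hom (Algebra.GrothendieckGroup.of (c₀ ^ n)) := by
      rw [d.divZeroHom_pow_intNonzeroToUnits, ← hc₀, map_pow, map_pow, d.phiGp_eq_monGp_map_of]
      rfl
    obtain ⟨w, -, hw⟩ := d.exists_B_of_compat (op X.base) _ _ hcompat
    have hbw : Algebra.GrothendieckGroup.of (1 : d.Φ.obj (op X.base)) =
        Frobenioids.divB d.Φ d.B d.divB (op X.base) (b * w) := by
      rw [map_one, map_mul, hγ, hw, map_pow, zpow_neg, zpow_natCast, inv_mul_cancel]
    exact ⟨ModelFrobenioid.unitEnd X 1 (b * w) hbw, ModelFrobenioid.unitEnd X (c₀ ^ n) w hw.symm,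
      d.unitEnd_mem_endSubmonoid X _ _ _, d.unitEnd_mem_endSubmonoid X _ _ _, rfl⟩

end PadicFrd.Datum

end Literature.AlgebraicGeometry.Frobenioids
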